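import Mathlib.Data.ZMod.Basic
import Mathlib.Data.Nat.Choose.Basic
import Mathlib.Data.Nat.Prime.Basic
import HarnessLib

/-!
# Jacobi's congruence for the binomial coefficient `C(2(p-1)/3, (p-1)/3)` modulo `p`

Topic `Literature/NumberTheory/GaussSums` (companion of `KummerSector.lean`, which proves from
Mathlib's `jacobiSum` API that `J(χ, χ) = a + bω` is primary of norm `p`, Ireland–Rosen
Prop. 8.3.4, whence `4p = A² + 27B²` with `A = 2a - b ≡ 1 (mod 3)`, Ireland–Rosen Ch. 8 §3,
Corollary and Theorem 2).

NAMED FACTS (D-0014; statements only, cited, no proofs) transcribing Cosgrave–Dilcher,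
*Mod p³ analogues of theorems of Gauss and Jacobi on binomial coefficients*, Acta Arith. 142
(2010) 103–118, p. 104:

> "In analogy to (1.1) we fix an odd prime `p` and integers `r, s` such that
> (1.6) `p ≡ 1 (mod 6)`, `4p = r² + 3s²`, `r ≡ 1 (mod 3)`, `s ≡ 0 (mod 3)`.
> The integer `r` is then uniquely determined. The following congruence, analogous to Gauss'
> Theorem 1, is due to Jacobi (1837); see [2, p. 291] for remarks and references.
> **Theorem 4 (Jacobi).** Let `p` and `r` be as in (1.6). Then
> (1.7) `C(2(p-1)/3, (p-1)/3) ≡ -r (mod p)`."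

(`[2]` = Berndt–Evans–Williams, *Gauss and Jacobi Sums*, Wiley 1998.) With `s = 3M` the side
condition (1.6) is the familiar `4p = L² + 27M²`, `L ≡ 1 (mod 3)` of Gauss (Ireland–Rosen 1990,
Ch. 8 §3, Prop. 8.3.2 and Theorem 2: existence, and uniqueness of `L` once `L ≡ 1 (mod 3)`).

* `CosgraveDilcher2010_1_6_unique` — the uniqueness clause of (1.6);
* `Jacobi1837_binomial` — Theorem 4, congruence (1.7), stated in `ZMod p`.

These ground the route item `Summit.QuantumAdvantage.QuantumAdvantage.Theses.ThirdFactorialPincer.JacobiCube`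
(stmt-QuantumAdvantage-11647), whose congruence `((p-1)/3)!³ · L ≡ (-1)^{(p-1)/3} (mod p)` is
Theorem 4 combined with Wilson's theorem: with `K = (p-1)/3`, `(3K)! = (p-1)! ≡ -1` and
`∏_{2K < j ≤ 3K} j ≡ (-1)^K K!`, so `C(2K, K) = (2K)!/(K!)² ≡ -(-1)^K/(K!)³`.

Design: `p : ℕ` with `Nat.Prime`, the parameters `r s : ℤ` (they may be negative; `Int.emod` by
the positive moduli `3` makes `r % 3 = 1` the printed `r ≡ 1 (mod 3)` also for negative `r`), the
congruence as an equation in `ZMod p` between the casts of the natural number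
`Nat.choose (2 * ((p - 1) / 3)) ((p - 1) / 3)` and of `-r`. For `p ≡ 1 (mod 6)` the divisions
`(p - 1) / 3` are exact. Mathlib has `Nat.choose`, `ZMod`, Wilson (`ZMod.wilsons_lemma`), Gauss
and Jacobi sums (`gaussSum`, `jacobiSum`) but no binomial-coefficient congruence of
Gauss/Jacobi type (searched: `choose.*ZMod`, `Jacobi`, `27 *`). Deliberately NOT here: the
existence half of (1.6) (a theorem, two lines from `KummerSector.jacobiSum_cubicMulChar_primary`,
left to provers), the mod `p²`/`p³` refinements (Theorems 5, 6 of the source), Gauss' Theorem 1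
for `p ≡ 1 (mod 4)`.
-/

namespace Literature.NumberTheory.GaussSums

/-- **Uniqueness in (1.6)** (Cosgrave–Dilcher 2010, p. 104: "we fix an odd prime `p` and
integers `r, s` such that `p ≡ 1 (mod 6)`, `4p = r² + 3s²`, `r ≡ 1 (mod 3)`, `s ≡ 0 (mod 3)`.
The integer `r` is then uniquely determined"; equivalently Ireland–Rosen 1990, Ch. 8 §3,
Theorem 2: in `4p = A² + 27B²`, "if we require that `A ≡ 1 (3)`, `A` is uniquely determined").
Named fact, not proved here. [cite: CosgraveDilcher2010, (1.6) p. 104] -/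
def CosgraveDilcher2010_1_6_unique : Prop :=
  ∀ (p : ℕ) (r s r' s' : ℤ), p.Prime → p % 6 = 1 →
    4 * (p : ℤ) = r ^ 2 + 3 * s ^ 2 → r % 3 = 1 → s % 3 = 0 →
    4 * (p : ℤ) = r' ^ 2 + 3 * s' ^ 2 → r' % 3 = 1 → s' % 3 = 0 → r' = r

/-- **Jacobi's theorem (1837)** (Cosgrave–Dilcher 2010, Theorem 4 with (1.6), congruence (1.7)):
let `p` be prime with `p ≡ 1 (mod 6)` and let `r, s ∈ ℤ` satisfy `4p = r² + 3s²`, `r ≡ 1 (mod 3)`,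
`s ≡ 0 (mod 3)`. Then `C(2(p-1)/3, (p-1)/3) ≡ -r (mod p)`. Stated in `ZMod p`. Named fact, not
proved here (classical proof via the cubic Jacobi sum `J(χ, χ)`, Berndt–Evans–Williams Ch. 9).
Grounds `Summit.QuantumAdvantage.QuantumAdvantage.Theses.ThirdFactorialPincer.JacobiCube`
together with Wilson's theorem. [cite: CosgraveDilcher2010, Thm 4 (1.7) p. 104] -/
def Jacobi1837_binomial : Prop :=
  ∀ (p : ℕ) (r s : ℤ), p.Prime → p % 6 = 1 →
    4 * (p : ℤ) = r ^ 2 + 3 * s ^ 2 → r % 3 = 1 → s % 3 = 0 →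
    ((Nat.choose (2 * ((p - 1) / 3)) ((p - 1) / 3) : ℕ) : ZMod p) = -((r : ℤ) : ZMod p)

end Literature.NumberTheory.GaussSums

/-! ### Sanity checks of the transcription (small primes, by `decide`)

`p = 7`: `4·7 = 1² + 3·3²`, `r = 1`, `C(4,2) = 6 ≡ -1 (mod 7)`;
`p = 13`: `4·13 = (-5)² + 3·3²`, `r = -5 ≡ 1 (mod 3)`, `C(8,4) = 70 ≡ 5 = -r (mod 13)`;
`p = 19`: `4·19 = 7² + 3·3²`, `r = 7`, `C(12,6) = 924 ≡ 12 = -7 (mod 19)`. -/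

example : ((Nat.choose (2 * ((7 - 1) / 3)) ((7 - 1) / 3) : ℕ) : ZMod 7) = -((1 : ℤ) : ZMod 7) := by
  decide
example : ((Nat.choose (2 * ((13 - 1) / 3)) ((13 - 1) / 3) : ℕ) : ZMod 13) = -((-5 : ℤ) : ZMod 13) := by
  decide
example : ((Nat.choose (2 * ((19 - 1) / 3)) ((19 - 1) / 3) : ℕ) : ZMod 19) = -((7 : ℤ) : ZMod 19) := by
  decide
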